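/-
Copyright (c) 2026 the pub-hodgecm-mathlib formalisation cell (harness21).  Prover seat hodgecm-mathlib-LH1-p03 (g5): line LH3 (closer stub `stub_N9`), letter L1
clause (I₃) ALL ORDERS, brick (B-wick), GENERIC LAYER (group-free trigonometry and jets); 2026-09-02.
-/
import Literature.Analysis.Distribution.LogWeightSchwartz   -- ★ `iteratedDeriv_cexp_mul_ofReal` (`(e^{cs})⁽ⁿ⁾ = cⁿe^{cs}`, real variable, complex `c`) — reused by name
import Mathlib.Analysis.SpecialFunctions.ExpDeriv           -- `ContDiff.cexp`
import Mathlib.Analysis.Complex.Circle                      -- `Circle.exp`, `Circle.coe_exp`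
import Mathlib.Analysis.SpecialFunctions.Trigonometric.DerivHyp  -- `Real.one_le_cosh`
import HarnessLib

/-!
# The Wick rotation of the wall cofactors: `2cos ν − 2cos δ` and `2cosh x − 2cos δ` have jets `(2cos)⁽ᵃ⁾(0) = iᵃ·(2cosh)⁽ᵃ⁾(0)`; product forms of both
# (Shelstad 1979 §4 Lemma 4.3; Varadarajan 1989 §6.4 Thm 24)

Topic `Analysis/Calculus`; namespace `Literature.Analysis.Calculus`.  THEOREMS ONLY (no definition, no instance, no notation, no axiom, no named fact, no `sorry`); Mathlib +
★ `LogWeightSchwartz` only; kernel lane `--kind proof --supports stmt-HodgeConjecture-24833`.  Cell `pub/hodgecm-mathlib` (D-0151), crux H413 = `stmt-HodgeConjecture-24833`,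
F0∕P3c line LH3 (closer stub `stub_N9`, DIRECT ROAD `F0_P3c_StubN9Direct`), letter L1 clause (I₃) `ArchHcJump` AT ALL ORDERS (LH3-plan (g3) RULING #14∕#16; F0P3a-p08 (g23)
SPEC-I3 v1.1 §5): the GENERIC layer of brick **(B-wick)** «cofactor Wick identity» (dressed layer = `Rogawski1990/ArchOrbFamGExtWallFactorWick`).
HONEST LABEL: HC_CM is proved only modulo the 7 printed citations (2 remaining named inputs: hLiu418 = `stmt-HodgeConjecture-24832`, h413 = `stmt-HodgeConjecture-24833`) until
rung 0 closes; count-neutral one-variable calculus.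

THE MATHEMATICS.  The root cofactor of Harish-Chandra's normalised orbital families at a noncompact imaginary wall of `U(2,1)` reads, on the compact Cartan along the wall
normal, `e^{iν}(1 − e^{i(φ−θ−ν)})(1 − e^{i(θ−ν−φ)}) = 2cos ν − 2cos(θ − φ)` (§1), and on the Cayley (split) Cartan along the real ray,
`‖e^{x+iθ} − e^{iφ}‖·‖e^{−x+iθ} − e^{iφ}‖ = 2cosh x − 2cos(θ − φ)` (§1: the product of the two complex-root factors is `e^{i(θ+φ)}(2cos(θ−φ) − 2cosh x)`, of modulus
`2cosh x − 2cos(θ−φ) ≥ 0`) — the two real forms `ν ↦ e^{iν}`, `x ↦ eˣ` of ONE trigonometric polynomial.  Writing `2cos ν = e^{iν} + e^{−iν}`, `2cosh x = eˣ + e⁻ˣ` and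
differentiating at `0` (§2, over ★ `iteratedDeriv_cexp_mul_ofReal`): `(2cos ν − 2cos δ)⁽ᵃ⁾(0) = iᵃ + (−i)ᵃ − [a=0]·2cos δ`, `(2cosh x − 2cos δ)⁽ᵃ⁾(0) = 1 + (−1)ᵃ − [a=0]·2cos δ`,
hence **`(2cos · − 2cos δ)⁽ᵃ⁾(0) = iᵃ · (2cosh · − 2cos δ)⁽ᵃ⁾(0)`** for every `a` — Shelstad's `∂_n ↦ i·∂_x` (Lemma 4.3) at the level of the cofactor jets.

WHAT IS PROVED.
* §1 `coe_circleExp_mul_one_sub_mul_one_sub_eq_two_cos_sub`, `norm_mul_norm_eq_two_cosh_sub_two_cos`.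
* §2 `contDiff_cexp_const_mul_ofReal`, `ofReal_two_cos_sub_eq`, `ofReal_two_cosh_sub_eq`, `contDiff_ofReal_two_cos_sub`, `contDiff_ofReal_two_cosh_sub`,
  `iteratedDeriv_ofReal_two_cos_sub_zero`, `iteratedDeriv_ofReal_two_cosh_sub_zero`, **`iteratedDeriv_ofReal_two_cos_sub_zero_eq_I_pow_mul`**.

## References
* [Shelstad1979] D. Shelstad, *Characters and inner forms of a quasi-split group over ℝ*, Compositio Math. 39 (1979), §4 Lemma 4.3 p. 25, Prop. 4.5 p. 26.
* [Varadarajan1989] V. S. Varadarajan, *An Introduction to Harmonic Analysis on Semisimple Lie Groups* (1989), §6.4 Thms 23–24.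
* [Rogawski1990] J. D. Rogawski, *Automorphic Representations of Unitary Groups in Three Variables*, Ann. of Math. Stud. 123 (1990), §8.2 pp. 118–124.
-/

set_option autoImplicit false

noncomputable section

open Complex Set Function Real Filter Topology
open scoped ContDiff

namespace Literature.Analysis.Calculus

/-! ## §1 Trigonometry of the two cofactors -/

/-- **`e^{iν}(1 − e^{i(φ−θ−ν)})(1 − e^{i(θ−ν−φ)}) = 2cos ν − 2cos(θ − φ)`** (the moving root factors of the compact wall factor `R`, ★ (c-wall) :54's tokens).
[cite: Rogawski1990, §8.2 p. 122] [cite: Shelstad1979, §4 p. 25] -/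
theorem coe_circleExp_mul_one_sub_mul_one_sub_eq_two_cos_sub (θ φ ν : ℝ) :
    (Circle.exp ν : ℂ) * ((1 - (Circle.exp (φ - θ - ν) : ℂ)) * (1 - (Circle.exp (θ - ν - φ) : ℂ))) = ((2 * Real.cos ν - 2 * Real.cos (θ - φ) : ℝ) : ℂ) := by
  -- atoms: `a = e^{iν}`, `a′ = e^{−iν}`, `t = e^{iθ}`, `t′ = e^{−iθ}`, `f = e^{iφ}`, `f′ = e^{−iφ}`
  have ha : cexp ((ν : ℂ) * I) * cexp (-((ν : ℂ) * I)) = 1 := by rw [← Complex.exp_add, add_neg_cancel, Complex.exp_zero]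
  have ht : cexp ((θ : ℂ) * I) * cexp (-((θ : ℂ) * I)) = 1 := by rw [← Complex.exp_add, add_neg_cancel, Complex.exp_zero]
  have hf : cexp ((φ : ℂ) * I) * cexp (-((φ : ℂ) * I)) = 1 := by rw [← Complex.exp_add, add_neg_cancel, Complex.exp_zero]
  have h1 : (Circle.exp (φ - θ - ν) : ℂ) = cexp ((φ : ℂ) * I) * cexp (-((θ : ℂ) * I)) * cexp (-((ν : ℂ) * I)) := by
    rw [Circle.coe_exp, ← Complex.exp_add, ← Complex.exp_add]; push_cast; ring_nf
  have h2 : (Circle.exp (θ - ν - φ) : ℂ) = cexp ((θ : ℂ) * I) * cexp (-((ν : ℂ) * I)) * cexp (-((φ : ℂ) * I)) := by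
    rw [Circle.coe_exp, ← Complex.exp_add, ← Complex.exp_add]; push_cast; ring_nf
  have h3 : ((2 * Real.cos ν - 2 * Real.cos (θ - φ) : ℝ) : ℂ) =
      (cexp ((ν : ℂ) * I) + cexp (-((ν : ℂ) * I))) - (cexp ((θ : ℂ) * I) * cexp (-((φ : ℂ) * I)) + cexp (-((θ : ℂ) * I)) * cexp ((φ : ℂ) * I)) := by
    push_cast
    rw [Complex.two_cos, Complex.two_cos, ← Complex.exp_add, ← Complex.exp_add]
    congr 1
    · rw [neg_mul]
    · congr 1 <;> (congr 1; ring)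
  rw [Circle.coe_exp, h1, h2, h3]
  linear_combination (-(cexp ((φ : ℂ) * I) * cexp (-((θ : ℂ) * I))) - cexp ((θ : ℂ) * I) * cexp (-((φ : ℂ) * I)) +
      cexp (-((ν : ℂ) * I)) * (cexp ((φ : ℂ) * I) * cexp (-((φ : ℂ) * I))) * (cexp ((θ : ℂ) * I) * cexp (-((θ : ℂ) * I)))) * ha +
    (cexp (-((ν : ℂ) * I)) * (cexp ((θ : ℂ) * I) * cexp (-((θ : ℂ) * I)))) * hf + cexp (-((ν : ℂ) * I)) * ht

/-- **`‖e^{x+iθ} − e^{iφ}‖·‖e^{−x+iθ} − e^{iφ}‖ = 2cosh x − 2cos(θ − φ)`** (the two complex-root factors of the split wall factor `R♯`, ★ `archRG_insert_eq_mul_prod_erase`'s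
tokens): their product is `e^{i(θ+φ)}·(2cos(θ−φ) − 2cosh x)`, of modulus `2cosh x − 2cos(θ−φ)`. [cite: Rogawski1990, §8.2 p. 119] [cite: Shelstad1979, §4 p. 25] -/
theorem norm_mul_norm_eq_two_cosh_sub_two_cos (x θ φ : ℝ) :
    ‖cexp (x + θ * I) - cexp (φ * I)‖ * ‖cexp (-x + θ * I) - cexp (φ * I)‖ = 2 * Real.cosh x - 2 * Real.cos (θ - φ) := by
  have hx : cexp (x : ℂ) * cexp (-(x : ℂ)) = 1 := by rw [← Complex.exp_add, add_neg_cancel, Complex.exp_zero]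
  have ht : cexp ((θ : ℂ) * I) * cexp (-((θ : ℂ) * I)) = 1 := by rw [← Complex.exp_add, add_neg_cancel, Complex.exp_zero]
  have hf : cexp ((φ : ℂ) * I) * cexp (-((φ : ℂ) * I)) = 1 := by rw [← Complex.exp_add, add_neg_cancel, Complex.exp_zero]
  have hprod : (cexp (x + θ * I) - cexp (φ * I)) * (cexp (-x + θ * I) - cexp (φ * I)) =
      (cexp ((θ : ℂ) * I) * cexp ((φ : ℂ) * I)) * ((2 * Real.cos (θ - φ) - 2 * Real.cosh x : ℝ) : ℂ) := by
    have h3 : ((2 * Real.cos (θ - φ) - 2 * Real.cosh x : ℝ) : ℂ) =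
        (cexp ((θ : ℂ) * I) * cexp (-((φ : ℂ) * I)) + cexp (-((θ : ℂ) * I)) * cexp ((φ : ℂ) * I)) - (cexp (x : ℂ) + cexp (-(x : ℂ))) := by
      push_cast
      rw [Complex.two_cos, Complex.two_cosh, ← Complex.exp_add, ← Complex.exp_add]
      congr 1
      congr 1 <;> (congr 1; ring)
    rw [h3, Complex.exp_add, Complex.exp_add]
    linear_combination (cexp ((θ : ℂ) * I) * cexp ((θ : ℂ) * I)) * hx - (cexp ((θ : ℂ) * I) * cexp ((θ : ℂ) * I)) * hf -
      (cexp ((φ : ℂ) * I) * cexp ((φ : ℂ) * I)) * ht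
  rw [← norm_mul, hprod, norm_mul, norm_mul, Complex.norm_exp_ofReal_mul_I, Complex.norm_exp_ofReal_mul_I, one_mul, one_mul, Complex.norm_real,
    Real.norm_eq_abs, abs_of_nonpos (by linarith [Real.one_le_cosh x, Real.cos_le_one (θ - φ)])]
  ring

/-! ## §2 The jets at `0` of `2cos ν − 2cos δ` and `2cosh x − 2cos δ` -/

/-- `ν ↦ e^{cν}` is `C^∞` in the real variable `ν`. [cite: Varadarajan1989, §6.4 Thm 24] -/
theorem contDiff_cexp_const_mul_ofReal (c : ℂ) : ContDiff ℝ ∞ (fun ν : ℝ => cexp (c * ν)) :=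
  (contDiff_const.mul Complex.ofRealCLM.contDiff).cexp

/-- `2cos ν − 2cos δ = e^{iν} + e^{−iν} − 2cos δ` as complex-valued functions of the real variable `ν`. [cite: Rogawski1990, §8.2 p. 122] -/
theorem ofReal_two_cos_sub_eq (δ : ℝ) :
    (fun ν : ℝ => ((2 * Real.cos ν - 2 * Real.cos δ : ℝ) : ℂ)) = fun ν : ℝ => cexp (I * ν) + cexp (-I * ν) - ((2 * Real.cos δ : ℝ) : ℂ) := by
  funext ν
  rw [Complex.ofReal_sub, Complex.ofReal_mul, Complex.ofReal_ofNat, Complex.ofReal_cos, Complex.two_cos]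
  congr 1
  congr 1 <;> (congr 1; ring)

/-- `2cosh x − 2cos δ = eˣ + e⁻ˣ − 2cos δ` as complex-valued functions of the real variable `x`. [cite: Rogawski1990, §8.2 p. 119] -/
theorem ofReal_two_cosh_sub_eq (δ : ℝ) :
    (fun x : ℝ => ((2 * Real.cosh x - 2 * Real.cos δ : ℝ) : ℂ)) = fun x : ℝ => cexp (1 * x) + cexp (-1 * x) - ((2 * Real.cos δ : ℝ) : ℂ) := by
  funext x
  rw [Complex.ofReal_sub, Complex.ofReal_mul 2, Complex.ofReal_ofNat, Complex.ofReal_cosh, Complex.two_cosh, one_mul, neg_mul, one_mul]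

/-- `ν ↦ 2cos ν − 2cos δ` (complex-valued) is `C^∞`. [cite: Rogawski1990, §8.2 p. 122] -/
theorem contDiff_ofReal_two_cos_sub (δ : ℝ) : ContDiff ℝ ∞ (fun ν : ℝ => ((2 * Real.cos ν - 2 * Real.cos δ : ℝ) : ℂ)) := by
  rw [ofReal_two_cos_sub_eq]
  exact ((contDiff_cexp_const_mul_ofReal I).add (contDiff_cexp_const_mul_ofReal (-I))).sub contDiff_const

/-- `x ↦ 2cosh x − 2cos δ` (complex-valued) is `C^∞`. [cite: Rogawski1990, §8.2 p. 119] -/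
theorem contDiff_ofReal_two_cosh_sub (δ : ℝ) : ContDiff ℝ ∞ (fun x : ℝ => ((2 * Real.cosh x - 2 * Real.cos δ : ℝ) : ℂ)) := by
  rw [ofReal_two_cosh_sub_eq]
  exact ((contDiff_cexp_const_mul_ofReal 1).add (contDiff_cexp_const_mul_ofReal (-1))).sub contDiff_const

/-- **`(2cos ν − 2cos δ)⁽ᵃ⁾(0) = iᵃ + (−i)ᵃ − [a = 0]·2cos δ`.** [cite: Varadarajan1989, §6.4 Thm 24] [cite: Shelstad1979, Lemma 4.3 (p. 25)] -/
theorem iteratedDeriv_ofReal_two_cos_sub_zero (δ : ℝ) (a : ℕ) :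
    iteratedDeriv a (fun ν : ℝ => ((2 * Real.cos ν - 2 * Real.cos δ : ℝ) : ℂ)) 0 = I ^ a + (-I) ^ a - (if a = 0 then ((2 * Real.cos δ : ℝ) : ℂ) else 0) := by
  rw [ofReal_two_cos_sub_eq]
  have h1 : ContDiffAt ℝ a (fun ν : ℝ => cexp (I * ν)) 0 := ((contDiff_cexp_const_mul_ofReal I).of_le (by exact_mod_cast le_top)).contDiffAt
  have h2 : ContDiffAt ℝ a (fun ν : ℝ => cexp (-I * ν)) 0 := ((contDiff_cexp_const_mul_ofReal (-I)).of_le (by exact_mod_cast le_top)).contDiffAt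
  have h3 : ContDiffAt ℝ a (fun _ : ℝ => ((2 * Real.cos δ : ℝ) : ℂ)) 0 := contDiffAt_const
  rw [iteratedDeriv_fun_sub (h1.add h2) h3, iteratedDeriv_fun_add h1 h2, Literature.Analysis.Distribution.iteratedDeriv_cexp_mul_ofReal, Literature.Analysis.Distribution.iteratedDeriv_cexp_mul_ofReal, iteratedDeriv_const]
  simp only [Complex.ofReal_zero, mul_zero, Complex.exp_zero, mul_one]

/-- **`(2cosh x − 2cos δ)⁽ᵃ⁾(0) = 1 + (−1)ᵃ − [a = 0]·2cos δ`.** [cite: Varadarajan1989, §6.4 Thm 24] [cite: Shelstad1979, Lemma 4.3 (p. 25)] -/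
theorem iteratedDeriv_ofReal_two_cosh_sub_zero (δ : ℝ) (a : ℕ) :
    iteratedDeriv a (fun x : ℝ => ((2 * Real.cosh x - 2 * Real.cos δ : ℝ) : ℂ)) 0 = 1 + (-1) ^ a - (if a = 0 then ((2 * Real.cos δ : ℝ) : ℂ) else 0) := by
  rw [ofReal_two_cosh_sub_eq]
  have h1 : ContDiffAt ℝ a (fun x : ℝ => cexp (1 * x)) 0 := ((contDiff_cexp_const_mul_ofReal 1).of_le (by exact_mod_cast le_top)).contDiffAt
  have h2 : ContDiffAt ℝ a (fun x : ℝ => cexp (-1 * x)) 0 := ((contDiff_cexp_const_mul_ofReal (-1)).of_le (by exact_mod_cast le_top)).contDiffAt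
  have h3 : ContDiffAt ℝ a (fun _ : ℝ => ((2 * Real.cos δ : ℝ) : ℂ)) 0 := contDiffAt_const
  rw [iteratedDeriv_fun_sub (h1.add h2) h3, iteratedDeriv_fun_add h1 h2, Literature.Analysis.Distribution.iteratedDeriv_cexp_mul_ofReal, Literature.Analysis.Distribution.iteratedDeriv_cexp_mul_ofReal, iteratedDeriv_const]
  simp only [Complex.ofReal_zero, mul_zero, Complex.exp_zero, mul_one, one_pow]

/-- **THE WICK ROTATION `∂_ν ↦ i·∂_x`: `(2cos ν − 2cos δ)⁽ᵃ⁾(0) = iᵃ · (2cosh x − 2cos δ)⁽ᵃ⁾(0)`** for every `a` (both vanish for odd `a`; `cos`∕`cosh` are the two real forms of one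
entire function). [cite: Shelstad1979, Lemma 4.3 (p. 25)] [cite: Varadarajan1989, §6.4 Thm 24] -/
theorem iteratedDeriv_ofReal_two_cos_sub_zero_eq_I_pow_mul (δ : ℝ) (a : ℕ) :
    iteratedDeriv a (fun ν : ℝ => ((2 * Real.cos ν - 2 * Real.cos δ : ℝ) : ℂ)) 0 =
      I ^ a * iteratedDeriv a (fun x : ℝ => ((2 * Real.cosh x - 2 * Real.cos δ : ℝ) : ℂ)) 0 := by
  rw [iteratedDeriv_ofReal_two_cos_sub_zero, iteratedDeriv_ofReal_two_cosh_sub_zero]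
  by_cases ha : a = 0
  · subst ha; simp
  · simp only [if_neg ha, sub_zero]
    ring

end Literature.Analysis.Calculus

end
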